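/-
Copyright: the b2b-balaban cell (near-miss cell 7), T⁴-continuum fan-out, lineage t4-ne7b-p3 (node U5c LARGE-DEVIATION
member P3).  Released under the licence of the surrounding project.
-/
import Summits.QuantumFields.BalabanUV.T4Continuum.Support.SpaceTimeInstance

/-!
# Space-time Peierls ∕ Cramér route for NE7b — THE RUN READINGS FROM REALISED LINEAGES: `RunReadingsFlow` at one
# `(K, t)` is inhabited by the torus occupancy model of the lineage data

Summits-side support leaf of the T⁴-continuum cell (rung (B)+1 on a FINITE torus only; NOT infinite volume, NOT the
mass gap, NOT the Clay statement; NOT a proof of the spine estimate NE7b).  Lineage `t4-ne7b-p3` (generation 2), node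
U5c, skeleton `t4/skeletons/NE7b-t4-ne7b-p3.md` §11.  [folklore] plumbing over `SpaceTimeInstance`
(`LinData.lineageReadings`) and `SpaceTimeAssembly` (`RunReadingsFlow`, consumed by `exists_irThreshold_relWeightBound`);
nothing printed is asserted; no `[cite:]` tag.

WHAT.  **`LinData.runReadingsFlow`**: the binder `RunReadingsFlow C L r β₀ x₀ T X Bad xup jstar Δ₁ Nanc (8·126^d)
(126^d) dC c₃ K t` of the route's FLOW END (`SpaceTimeAssembly.exists_irThreshold_relWeightBound`) is witnessed by
the cell type `STCellV d n L Kx K ℓ`, the model `D.model` of the run's lineage data at `(K, t)` (`D.T = T K`), the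
entropy constants `Δ = 3^d + L^{2d} + 1`, `Δ₁ = (Δ+1)²`, `Nanc = (n·L^{Kx − ℓ K})^d`, the run's flow `(Kc, R, g, β′)`
with its typed facts ((2.7), (2.9), (2.5), `1 ≤ log g⁻²`, the infrared value `x₀ ≤ log g_{Kc}⁻²`), and
`LinData.lineageReadings` — so the types of the whole chain LINE UP: realised lineage data + readings (i)–(vii) + flow
facts at every `(K, t)` from `K₀` on, for both runs, feed the END verbatim.

HONEST DEPENDENCY (cell, verbatim): continuum YM on T⁴ ⇐ BetaPertH ∧ nine spine estimates (0/9 proved); BetaPertH ⇐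
(D1) ∧ (D4) ∧ CAP+tail; G-an2-4 gates asym, D1 and NE2/3/4.  This file changes none of it.
-/

open Finset

namespace Summit.QuantumFields.BalabanUV.T4Continuum.SpaceTimePeierls

open Literature.MathematicalPhysics.QuantumFieldTheory.Balaban1983to89
open Literature.MathematicalPhysics.QuantumFieldTheory.Balaban1983to89.B13ScaleTransfer
open Literature.MathematicalPhysics.QuantumFieldTheory.Balaban1983to89.B16SProfile
open T4PersistenceDictionary T4BankedInduction T4PrintedShapeBanking
open Summit.QuantumFields.BalabanUV.T4Continuum.ZoneTorus
open SpaceTimePeierlsLeaves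

noncomputable section

open Classical

namespace LinData

variable {d n L Kx K : ℕ} {ℓ : ℕ → ℕ} {ι Λ : Type*} (D : LinData d n L Kx K ℓ ι Λ PEv)

/-- **`RunReadingsFlow` AT ONE `(K, t)` FROM REALISED LINEAGE DATA.**  The lineage data `D` of the run at `(K, t)`
(terms `D.T = T K`), the readings (i)–(vii) of `LinData.lineageReadings` for the weights `X K t`, bad class `Bad K t`,
window floor `jstar K` and envelope `xup K t`, and the run's typed flow facts with the infrared value `x₀`, inhabit
`RunReadingsFlow` with `Δ₁ = (3^d + L^{2d} + 2)²`, `Nanc = (n·L^{Kx − ℓ K})^d`, `cA = 8·126^d`, `cB = 126^d`.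
[folklore] -/
theorem runReadingsFlow {C : T4PrintedShapeBanking.Consts} {r : ℕ} {β₀ x₀ β' : ℝ} {T : ℕ → Finset ι}
    {X : ℕ → ℝ → ι → ℝ} {Bad : ℕ → ℝ → Finset ι} {xup : ℕ → ℝ → ℝ} {jstar : ℕ → ℕ} {dC c₃ : ℝ} {t : ℝ}
    {Kc : ℕ} {R : ℕ → ℕ} {g : ℕ → ℝ} {σ : ℕ → ℕ} {m : ℕ} {rest : Finset (STCellV d n L Kx K ℓ) → ι → ℝ}
    (hT : D.T = T K)
    -- the typed flow facts of the run and the infrared value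
    (h27 : B14.FlowIneq27 g β' β₀ C.p₀ Kc) (h29 : B14FlowStep.FlowIneq29 R g L β' β₀ Kc)
    (hRj : ∀ s, s ≤ Kc → B14.IsRj L r (g s) (R s)) (hx1 : ∀ s, s ≤ Kc → 1 ≤ Real.log ((g s) ^ 2)⁻¹)
    (hxK : x₀ ≤ Real.log ((g Kc) ^ 2)⁻¹)
    -- the hypotheses of `lineageReadings`
    (hn : 0 < n) (hL : 4 ≤ L) (hmono : ∀ u, ℓ u ≤ ℓ (u + 1)) (hjump : ∀ u, ℓ (u + 1) ≤ ℓ u + 2)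
    (hq : D.q = ratio L σ) (hqℓ : ∀ u, D.q u = L ^ (ℓ (u + 1) - ℓ u)) (hdrop : DropCtl σ m) (hK : K ≤ m)
    (hdC : 0 ≤ dC) (hstep : D.step = PEv.step)
    (hnonneg : ∀ τ ∈ D.T, 0 ≤ X K t τ) (hBad : Bad K t ⊆ D.T) (hjlo : jstar K ≤ K)
    (hold : ∀ τ ∈ Bad K t, ∃ lam ∈ D.fam τ, ∃ b ∈ (D.G lam).events, D.step b ≤ jstar K ∧ (D.piece b).Nonempty)
    (hsep : D.Separated)
    (hlin : ∀ τ ∈ D.T, ∀ lam ∈ D.fam τ, Consistent C Kc R (D.G lam) ∧ (D.G lam).WF (dictW R C.n₁) ∧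
      K + 1 ≤ (D.G lam).reach (dictW R C.n₁) ∧ SkelOK D.q D.step D.piece PEv.fat dC (D.G lam))
    (hfac : ∀ (𝒦 : Finset (STCellV d n L Kx K ℓ)), ∀ τ ∈ D.T, D.model.IsContour τ 𝒦 → ∀ lam ∈ D.fam τ,
      (∀ c ∈ 𝒦, D.InLin lam c) →
        X K t τ ≤ Real.exp (-(credits (credit C g) (D.G lam) - lifeCost (dictW R C.n₁) (cost C Kc R) (D.G lam))) *
          rest 𝒦 τ)
    (hrest0 : ∀ (𝒦 : Finset (STCellV d n L Kx K ℓ)), ∀ τ ∈ D.T, 0 ≤ rest 𝒦 τ)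
    (hrest : ∀ (𝒦 : Finset (STCellV d n L Kx K ℓ)),
      ∑ τ ∈ D.model.T.filter (fun τ => D.model.IsContour τ 𝒦), rest 𝒦 τ ≤ Real.exp c₃ ^ 𝒦.card * xup K t) :
    RunReadingsFlow C L r β₀ x₀ T X Bad xup jstar ((((3 ^ d + L ^ (2 * d) + 1 : ℕ) : ℝ) + 1) ^ 2)
      (((n * L ^ (Kx - ℓ K)) ^ d : ℕ) : ℝ) (8 * 126 ^ d) (126 ^ d) dC c₃ K t :=
  ⟨STCellV d n L Kx K ℓ, inferInstance, inferInstance, D.model, inferInstance, 3 ^ d + L ^ (2 * d) + 1, Kc, R, g, β',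
    hT, h27, h29, hRj, hx1, hxK,
    D.lineageReadings hn hL hmono hjump hq hqℓ hdrop hK hdC hstep hnonneg hBad hjlo hold hsep hlin hfac hrest0 hrest⟩

end LinData

end

end Summit.QuantumFields.BalabanUV.T4Continuum.SpaceTimePeierls
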